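import Literature.NumberTheory.PAdicHodge.TateAlmostEtalePChain

/-!
# Tate's almost étale lemma (TS1) — Prop. 9 for a finite Galois `L/K_∞` via Sylow (dévissage D′2)

Dévissage step D′2 of the elementary Kummer route to the Tate–Sen axiom
`tate1967_TS1_completedAlgClosure`: for `K_∞ ⊆ L₂ ⊆ L ⊆ F̄` with `L/K_∞` finite Galois,
`G = Gal(L/K_∞)`, `H = Gal(L/L₂)`, a Sylow `p`-subgroup `P_H` of `H` and a Sylow `P ⊇ P_H` of `G`:
* `L^P` is prime-to-`p` over `K_∞`, so its almost-perfectoid package is the TAME hypothesis (C);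
* the package ascends along the `p`-chain `P_H ≤ P` to `L^{P_H}` (`pChain_package`, D′1);
* `L/L^{P_H}` is Galois of `p`-power degree, so `pGalois_package_and_trace` (D_p) gives `y ∈ L` with
  `Tr_{L/L^{P_H}}(y) = 1` and `‖y‖ ≤ ‖p‖^{-ε}`;
* `[L^{P_H} : L₂] = [H : P_H]` is prime to `p`, a `p`-adic unit, and dividing by it gives
  `Tr_{L/L₂}(y / [L^{P_H}:L₂]) = 1` with the same norm bound.

Main result: `prop9_galois_of_tame`. The tame package (C) is taken as a hypothesis, stated in the
tree's vocabulary (no new definition). [cite: Tate1967, §3.2 Prop. 9] [cite: BergerColmez2008, Prop. 4.1.1]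
-/

noncomputable section

open Polynomial IntermediateField Module ValuativeRel Field

namespace Literature.NumberTheory.PAdicHodge

namespace TateAlmostEtale

open Literature.NumberTheory.GaloisRepresentations
open Literature.NumberTheory.GaloisRepresentations.IsNonarchimedeanLocalField

variable {F : Type} [Field F] [ValuativeRel F] [TopologicalSpace F] [IsNonarchimedeanLocalField F]
  [CharZero F] {p : ℕ} [Fact p.Prime] (hp : valuation F p < 1)

/-- Index bookkeeping for `P_H ∈ Syl_p(H)`, `H ≤ G`: if `a · |H| = |G|`, `a · d = b` and
`b · |P_H| = |G|` then `d = [H : P_H]`. [folklore] -/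
private theorem index_eq_of_cards {a b d cH cP iP : ℕ} (ha : 0 < a) (hcP : 0 < cP)
    (h1 : a * cH = b * cP) (h2 : a * d = b) (h3 : iP * cP = cH) : d = iP := by
  subst h2; subst h3
  have : a * (d * cP) = a * (iP * cP) := by rw [← mul_assoc]; exact h1.symm
  exact Nat.eq_of_mul_eq_mul_right hcP (Nat.eq_of_mul_eq_mul_left ha this)

set_option synthInstance.maxHeartbeats 200000 in
set_option maxHeartbeats 1600000 in
/-- **Tate's Prop. 9 for a finite Galois `L/K_∞` and every intermediate field `L₂`, granted the
tame package (C).** If every finite extension `T ⊇ K_∞` inside `F̄` of degree prime to `p` is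
almost-perfectoid (hypothesis `hC`: (Γ) and (U_s) for some `s > 0`), then for `K_∞ ⊆ L₂ ⊆ L ⊆ F̄` with
`L/K_∞` finite Galois and every `ε > 0` there is `y ∈ L` with `Tr_{L/L₂}(y) = 1` and `‖y‖ ≤ ‖p‖^{-ε}`
(Sylow reduction to `pChain_package` and `pGalois_package_and_trace`).
[cite: Tate1967, §3.2 Prop. 9] [cite: BergerColmez2008, Prop. 4.1.1] -/
theorem prop9_galois_of_tame
    (hC : ∀ (T : IntermediateField (TateTrace.Kinf hp) (NormedAlgClosure F)),
      FiniteDimensional (TateTrace.Kinf hp) T → ¬ p ∣ finrank (TateTrace.Kinf hp) T →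
      ∃ s : ℝ, 0 < s ∧ (∀ x ∈ T, x ≠ 0 → ∃ c ∈ T, ‖c‖ ^ p = ‖x‖) ∧
        (∀ u ∈ T, ‖u‖ ≤ 1 → ∃ w ∈ T, ‖u - w ^ p‖ ≤ ‖(p : NormedAlgClosure F)‖ ^ s))
    (L : IntermediateField (TateTrace.Kinf hp) (NormedAlgClosure F))
    [FiniteDimensional (TateTrace.Kinf hp) L] [IsGalois (TateTrace.Kinf hp) L]
    (L₂ : IntermediateField (TateTrace.Kinf hp) L) {ε : ℝ} (hε : 0 < ε) :
    ∃ y : L, Algebra.trace L₂ L y = 1 ∧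
      ‖((y : L) : NormedAlgClosure F)‖ ≤ ‖(p : NormedAlgClosure F)‖ ^ (-ε) := by
  classical
  have hprime : p.Prime := Fact.out
  have hq1 : ‖(p : NormedAlgClosure F)‖ < 1 := by
    rw [PadicBase.norm_natCast_closure hp]; exact PadicBase.norm_p_lt_one hp
  -- the groups `H = Gal(L/L₂) ≤ G = Gal(L/K_∞)`, Sylow subgroups `P_H ≤ P`
  set H : Subgroup (L ≃ₐ[TateTrace.Kinf hp] L) := L₂.fixingSubgroup with hH
  have hL₂ : IntermediateField.fixedField H = L₂ := IsGalois.fixedField_fixingSubgroup L₂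
  obtain ⟨PH⟩ : Nonempty (Sylow p H) := Sylow.nonempty
  set PH' : Subgroup (L ≃ₐ[TateTrace.Kinf hp] L) := (PH : Subgroup H).map H.subtype with hPH'
  have hPH'p : IsPGroup p PH' := PH.isPGroup'.map H.subtype
  obtain ⟨P, hP⟩ := hPH'p.exists_le_sylow
  have hPH'H : PH' ≤ H := by rw [hPH']; exact Subgroup.map_subtype_le _
  have hcardPH' : Nat.card PH' = Nat.card PH := by
    rw [hPH']; exact Subgroup.card_map_of_injective H.subtype_injective
  -- degrees
  have hG : Nat.card (L ≃ₐ[TateTrace.Kinf hp] L) = finrank (TateTrace.Kinf hp) L :=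
    IsGalois.card_aut_eq_finrank _ _
  have hHL : finrank L₂ L = Nat.card H := by
    rw [← hL₂]; exact IntermediateField.finrank_fixedField_eq_card H
  set X : IntermediateField (TateTrace.Kinf hp) L := IntermediateField.fixedField PH' with hX
  have hle : L₂ ≤ X := by
    intro x hx
    rw [hX, IntermediateField.mem_fixedField_iff]
    intro g hg
    have hx' : x ∈ IntermediateField.fixedField H := by rw [hL₂]; exact hx
    rw [IntermediateField.mem_fixedField_iff] at hx'
    exact hx' g (hPH'H hg)
  have hXL : finrank X L = Nat.card PH' := by
    rw [hX]; exact IntermediateField.finrank_fixedField_eq_card PH'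
  set XP : IntermediateField (TateTrace.Kinf hp) L :=
    IntermediateField.fixedField (P : Subgroup (L ≃ₐ[TateTrace.Kinf hp] L)) with hXP
  have hXPL : finrank XP L = Nat.card P := by
    rw [hXP]; exact IntermediateField.finrank_fixedField_eq_card _
  -- (C) for `T = L^P`, of degree `[G : P]` prime to `p`
  set T : IntermediateField (TateTrace.Kinf hp) (NormedAlgClosure F) := IntermediateField.lift XP
    with hT
  haveI hTfin : FiniteDimensional (TateTrace.Kinf hp) T :=
    LinearEquiv.finiteDimensional (IntermediateField.liftAlgEquiv XP).toLinearEquiv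
  have hTrk : finrank (TateTrace.Kinf hp) T =
      (P : Subgroup (L ≃ₐ[TateTrace.Kinf hp] L)).index := by
    have h1 : finrank (TateTrace.Kinf hp) T = finrank (TateTrace.Kinf hp) XP :=
      (IntermediateField.liftAlgEquiv XP).toLinearEquiv.finrank_eq.symm
    have h2 := Module.finrank_mul_finrank (TateTrace.Kinf hp) XP L
    rw [hXPL, ← hG, ← (P : Subgroup (L ≃ₐ[TateTrace.Kinf hp] L)).index_mul_card] at h2
    rw [h1]
    exact Nat.eq_of_mul_eq_mul_right Nat.card_pos h2
  have hnd : ¬ p ∣ finrank (TateTrace.Kinf hp) T := by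
    rw [hTrk]; exact P.not_dvd_index
  obtain ⟨s, hs, hΓT, hUT⟩ := hC T hTfin hnd
  -- (D′1): the package of `L^{P_H}`
  obtain ⟨s₁, hs₁, hΓ₁, hU₁⟩ := pChain_package hp (TateTrace.Kinf hp) le_rfl L
    (P : Subgroup (L ≃ₐ[TateTrace.Kinf hp] L)) PH' hP P.isPGroup' hs hΓT hUT
  -- degrees: `d = [X : L₂] = [H : P_H]` is prime to `p`, `[L : X] = |P_H| = p^k`
  set X' : IntermediateField L₂ L := IntermediateField.extendScalars hle with hX'
  haveI : IsGalois L₂ L := IsGalois.tower_top_of_isGalois (TateTrace.Kinf hp) L₂ L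
  haveI : IsGalois X' L := IsGalois.tower_top_of_isGalois L₂ X' L
  set d : ℕ := finrank L₂ X' with hd
  have hd1 : finrank (TateTrace.Kinf hp) L₂ * d = finrank (TateTrace.Kinf hp) X := by
    rw [hd, hX', ← IntermediateField.relfinrank_eq_finrank_of_le hle]
    exact IntermediateField.finrank_bot_mul_relfinrank hle
  have hd2 : finrank (TateTrace.Kinf hp) X * Nat.card PH' = Nat.card (L ≃ₐ[TateTrace.Kinf hp] L) := by
    rw [hG, ← hXL]; exact Module.finrank_mul_finrank _ X L
  have hd3 : finrank (TateTrace.Kinf hp) L₂ * Nat.card H = Nat.card (L ≃ₐ[TateTrace.Kinf hp] L) := by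
    rw [hG, ← hHL]; exact Module.finrank_mul_finrank _ L₂ L
  have hd4 : (PH : Subgroup H).index * Nat.card PH = Nat.card H := (PH : Subgroup H).index_mul_card
  have hdeq : d = (PH : Subgroup H).index := by
    refine index_eq_of_cards Module.finrank_pos Nat.card_pos (hd3.trans hd2.symm) hd1 ?_
    rw [hcardPH']; exact hd4
  have hdp : ¬ p ∣ d := by rw [hdeq]; exact PH.not_dvd_index
  have hd0 : d ≠ 0 := fun h => hdp (h ▸ dvd_zero p)
  have hX'L : finrank X' L = Nat.card PH' := by
    have h := Module.finrank_mul_finrank L₂ X' L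
    rw [hHL, ← hd4, ← hcardPH', ← hd, hdeq] at h
    exact Nat.eq_of_mul_eq_mul_left Nat.card_pos h  -- wait: index pos
  obtain ⟨k, hk⟩ := IsPGroup.iff_card.mp hPH'p
  -- the `E`-world: base `M = lift X` over `K₀`, top `L' = L` over `M`
  set M : IntermediateField (PadicBase F p hp) (NormedAlgClosure F) :=
    (IntermediateField.lift X).restrictScalars (PadicBase F p hp) with hM
  have hmemM : ∀ x : NormedAlgClosure F, x ∈ M ↔ x ∈ IntermediateField.lift X := fun x =>
    IntermediateField.mem_restrictScalars (PadicBase F p hp)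
  have hKM : TateTrace.Kinf hp ≤ M := by
    intro x hx
    rw [hmemM]
    have hxL : x ∈ L := L.algebraMap_mem ⟨x, hx⟩
    have : (⟨x, hxL⟩ : L) = algebraMap (TateTrace.Kinf hp) L ⟨x, hx⟩ := Subtype.ext rfl
    have hxX : (⟨x, hxL⟩ : L) ∈ X := by rw [this]; exact X.algebraMap_mem _
    exact (IntermediateField.mem_lift (⟨x, hxL⟩ : L)).mpr hxX
  have hΓM : ∀ x ∈ M, x ≠ 0 → ∃ c ∈ M, ‖c‖ ^ p = ‖x‖ := by
    intro x hx hx0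
    obtain ⟨c, hc, h⟩ := hΓ₁ x ((hmemM x).mp hx) hx0
    exact ⟨c, (hmemM c).mpr hc, h⟩
  have hUM : ∀ u ∈ M, ‖u‖ ≤ 1 → ∃ w ∈ M, ‖u - w ^ p‖ ≤ ‖(p : NormedAlgClosure F)‖ ^ s₁ := by
    intro u hu hu1
    obtain ⟨w, hw, h⟩ := hU₁ u ((hmemM u).mp hu) hu1
    exact ⟨w, (hmemM w).mpr hw, h⟩
  have hML : M ≤ L.restrictScalars (PadicBase F p hp) := by
    intro x hx
    rw [IntermediateField.mem_restrictScalars]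
    exact IntermediateField.lift_le X ((hmemM x).mp hx)
  set L' : IntermediateField M (NormedAlgClosure F) := IntermediateField.extendScalars hML with hL'
  have hmemL' : ∀ x : NormedAlgClosure F, x ∈ L' ↔ x ∈ L := fun x => Iff.rfl
  -- the transport equivalences (identity on `F̄`)
  let f : X' ≃+* M :=
    { toFun := fun x => ⟨((x : L) : NormedAlgClosure F),
        (hmemM _).mpr ((IntermediateField.mem_lift (x : L)).mpr x.2)⟩
      invFun := fun m => ⟨⟨(m : NormedAlgClosure F),
          IntermediateField.lift_le X ((hmemM _).mp m.2)⟩,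
          (IntermediateField.mem_lift (⟨(m : NormedAlgClosure F),
            IntermediateField.lift_le X ((hmemM _).mp m.2)⟩ : L)).mp ((hmemM _).mp m.2)⟩
      left_inv := fun x => rfl
      right_inv := fun m => rfl
      map_mul' := fun x y => rfl
      map_add' := fun x y => rfl }
  let g : L ≃+* L' :=
    { toFun := fun y => ⟨(y : NormedAlgClosure F), (hmemL' _).mpr y.2⟩
      invFun := fun y => ⟨(y : NormedAlgClosure F), (hmemL' _).mp y.2⟩
      left_inv := fun y => rfl
      right_inv := fun y => rfl
      map_mul' := fun x y => rfl
      map_add' := fun x y => rfl }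
  have hgE : ∀ y : L, ((g y : L') : NormedAlgClosure F) = (y : NormedAlgClosure F) := fun y => rfl
  have hcomp : (algebraMap M L').comp f.toRingHom = g.toRingHom.comp (algebraMap X' L) := by
    ext x; rfl
  haveI : IsGalois M L' := IsGalois.of_equiv_equiv (F := X') (E := L) (f := f) (g := g) hcomp
  haveI : FiniteDimensional M L' := Module.Finite.of_equiv_equiv f g hcomp
  have hfin' : finrank M L' = p ^ k := by
    rw [← Algebra.finrank_eq_of_equiv_equiv f g hcomp, hX'L, hk]
  -- (D_p): the trace-one element over `L^{P_H}`
  obtain ⟨-, htr⟩ := pGalois_package_and_trace hp M hKM hs₁ hΓM hUM L' hfin'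
  obtain ⟨y', hy'tr, hy'n⟩ := htr ε hε
  set y : L := g.symm y' with hy
  have hgy : g y = y' := by rw [hy]; exact g.apply_symm_apply y'
  have hytr : Algebra.trace X' L y = 1 := by
    have h := Algebra.trace_eq_of_equiv_equiv f g hcomp y
    rw [hgy, hy'tr, map_one] at h
    exact h
  have hyn : ‖((y : L) : NormedAlgClosure F)‖ ≤ ‖(p : NormedAlgClosure F)‖ ^ (-ε) := by
    rw [← hgE y, hgy]; exact hy'n
  -- divide by `d = [X : L₂]`, a `p`-adic unit
  haveI : CharZero L₂ :=
    charZero_of_injective_algebraMap (algebraMap (PadicBase F p hp) L₂).injective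
  have hdL₂ : (d : L₂) ≠ 0 := Nat.cast_ne_zero.mpr hd0
  refine ⟨(d : L₂)⁻¹ • y, ?_, ?_⟩
  · rw [map_smul, ← Algebra.trace_trace (S := X'), hytr,
      show (1 : X') = algebraMap L₂ X' 1 from (map_one _).symm, Algebra.trace_algebraMap,
      smul_eq_mul, nsmul_eq_mul, mul_one, ← hd, inv_mul_cancel₀ hdL₂]
  · have hcoe : ((((d : L₂)⁻¹ • y : L) : NormedAlgClosure F)) =
        ((d : NormedAlgClosure F))⁻¹ * ((y : L) : NormedAlgClosure F) := by
      rw [Algebra.smul_def]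
      push_cast
      congr 1
    rw [hcoe, norm_mul, norm_inv, norm_natCast_eq_one_of_not_dvd hprime hq1 hdp, inv_one, one_mul]
    exact hyn

end TateAlmostEtale

end Literature.NumberTheory.PAdicHodge

end
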